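import Literature.NumberTheory.EllipticCurves.LangHeightSmallPoints
import Literature.NumberTheory.EllipticCurves.Tamagawa
import Literature.NumberTheory.DiophantineGeometry.Conductor
import HarnessLib

/-!
# Petsche's non-archimedean estimate: Lemma 3 and the Kodaira–Néron/Ogg bound (named facts)

Topic `NumberTheory/EllipticCurves` (family `abc`, G06). Next layer of the decomposition of
`Literature.NumberTheory.EllipticCurves.szpiro_imp_langHeightLowerBoundConjecture` (Szpiro ⇒ Lang
over `ℚ`; Hindry–Silverman 1988, Thm. 0.3), below the non-archimedean estimate
`Literature.NumberTheory.EllipticCurves.Petsche2006_le_finsum_localHeightDiscSum`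
(file `LangHeightSmallPoints.lean`; Petsche 2006, proof of Prop. 7:
`Σ_{v fin} Λ_v(Z) ≥ (1/12)(1/(16σ²) − 1/N) log N(𝔇)`), whose printed proof combines

* **Lemma 3** (Petsche 2006, p. 260; a variant of Hindry–Silverman, *On Lehmer's conjecture for
  elliptic curves*, Prop. 1.2): for a non-archimedean place `v` and `N` distinct points
  `Z ⊂ E(k_v)`, `Λ_v(Z) ≥ (1/c_v² − 1/N) (1/12) log|1/Δ_v|_v`, where `c_v = |E(k_v)/E₀(k_v)|` and
  `Δ_v` is the discriminant of a minimal equation at `v` — proved there from Tate's uniformisation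
  (`E₀ = ker r`, `j_v = ½ B₂(r(P−Q)) log|j_E|_v`, positivity of the Fourier coefficients of `B₂`)
  and ATAEC VI.4.1;
* the local inequality **(30)** `η_v² c_v² ≤ 16 δ_v²` at the bad places (conductor exponent `η_v`,
  `δ_v = ord_v Δ_v`), which Petsche derives from the **Kodaira–Néron theorem** ("if `E/k_v` has
  split multiplicative reduction then `δ_v = c_v` and `η_v = 1` …; while otherwise `η_v ≤ δ_v` and
  `c_v ≤ 4`"; Silverman AEC Thm. VII.6.1, ATAEC Cor. IV.9.2(d)) and Ogg's formula — the tree already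
  carries Kodaira–Néron as the named facts `WeierstrassCurve.index_goodReductionSubgroup_le_four`,
  `WeierstrassCurve.index_goodReductionSubgroup_of_hasSplitMultiplicativeReduction` (file
  `KodairaNeron.lean`; finiteness is proved for finite residue fields in `TamagawaNeZeroProofs.lean`,
  and the bridge `c_v = ord_v Δ_min` for split multiplicative reduction in
  `NeronComponentDataAssembly.lean`), which the sibling proof file consumes directly;
* Ogg's formula `η_v ≤ δ_v`, `η_v = 1` for multiplicative reduction, the factorisations
  `N(𝔣) = ∏ p_v^{η_v}`, `N(𝔇) = ∏ p_v^{δ_v}` and Jensen's inequality — all available in the tree or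
  elementary (sibling proof file `LangHeightNonarchEstimateProofs.lean`, which derives (30) from the
  Kodaira–Néron facts and then proves `Petsche2006_le_finsum_localHeightDiscSum` from Lemma 3 and
  the local decomposition ATAEC VI.2.1).

This file introduces the place-indexed local Tamagawa number `W.tamagawaNumberAt v = c_v` (an
`abbrev` for the factor of `WeierstrassCurve.tamagawaProduct`, file `Tamagawa.lean`) and vendors
Petsche's Lemma 3 over `ℚ` as a named fact (D-0014).

## Design choices

* Places of `ℚ` are `v : HeightOneSpectrum ℤ` as in `Conductor.lean`, `MinimalDiscriminant.lean`,
  `NeronLocalHeight.lean`: `p_v = Rat.HeightOneSpectrum.natGenerator v`, `|·|_v = padicAbv v`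
  (`|p_v|_v = p_v⁻¹`), so `log|1/Δ_v|_v = δ_v · log p_v` with `δ_v = W.ordMinimalDiscriminant v`;
  `η_v = W.conductorExponent v`; `c_v = W.tamagawaNumberAt v`, the index `[E(ℚ_v) : E₀(ℚ_v)]` over
  the completion (Mathlib `IsDedekindDomain.HeightOneSpectrum.adicCompletion`), computed on the
  minimal model as in `Tamagawa.lean` (`AddSubgroup.index`, junk value `0` for an infinite index —
  excluded for elliptic curves by Kodaira–Néron, which is part of the second fact).
* Lemma 3 is stated for the points of `E(ℚ) ⊂ E(ℚ_v)` only (all that Prop. 7 uses), with the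
  Néron local height `neronLocalHeight (padicAbv v)` of `NeronLocalHeight.lean` (Tate's series; the
  restriction of `λ_v` on `E(ℚ_v)`, ATAEC VI.1.1) inside `Petsche2006.localHeightDiscSum`.
* `tamagawaNumberAt` is an `abbrev`, so that the tree's statements about `c_v`, which are phrased
  on the inline expression `(W.baseChange K_v).localTamagawaNumber O_v` (`Tamagawa.lean`,
  `KodairaNeron.lean`, `NeronTamagawa.lean`, `NeronComponentDataAssembly.lean`,
  `TamagawaNeZeroProofs.lean`), apply to it by `rw`/`simp` as well as definitionally; that inline
  form (equivalently `((W.localMinimalModel v).goodReductionSubgroup O_v).index`,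
  `WeierstrassCurve.localTamagawaNumber_baseChange_eq`) remains the canonical one.
* Mathlib / tree search: `lean search 'tamagawaNumberAt|TamagawaAt'` — no place-indexed `c_v`;
  `localTamagawaNumber`, `tamagawaProduct` (`Tamagawa.lean`) and the Kodaira–Néron facts
  (`KodairaNeron.lean`) are reused, not redefined.

## References

* C. Petsche, *Small rational points on elliptic curves over number fields*, New York J. Math. 12
  (2006), 257–268; arXiv math/0508160: Lemma 3 (p. 260), proof of Prop. 7, display (30) (p. 264).
* M. Hindry, J. H. Silverman, *On Lehmer's conjecture for elliptic curves*, Sém. Théorie des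
  Nombres Paris 1988–89, Progr. Math. 91 (1990), 103–116, Prop. 1.2.
* J. H. Silverman, *Advanced Topics in the Arithmetic of Elliptic Curves*, GTM 151 (1994), IV.9
  (Table 4.1, Cor. 9.2), IV.11.1 (Ogg's formula), VI.4.1; *The Arithmetic of Elliptic Curves*,
  2nd ed. (2009), Thm. VII.6.1 (Kodaira–Néron).
-/

noncomputable section

open scoped Classical

open IsDedekindDomain

/-! ### The local Tamagawa number at a finite place -/

namespace WeierstrassCurve

section TamagawaAt

variable {A : Type*} [CommRing A] [IsDedekindDomain A] {K : Type*} [Field K] [Algebra A K]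
  [IsFractionRing A K]

/-- `W.tamagawaNumberAt v = c_v = [E(K_v) : E₀(K_v)]`: the local Tamagawa number of `W / K` at the
finite place `v` of the Dedekind domain `A` (fraction field `K`), i.e.
`WeierstrassCurve.localTamagawaNumber` of the base change of `W` to the completion `K_v`
(`v.adicCompletion K`) with respect to its valuation ring `O_v` (`v.adicCompletionIntegers K`) — the
factor at `v` of `WeierstrassCurve.tamagawaProduct` (file `Tamagawa.lean`, where `A = 𝓞 K`).
Silverman, AEC VII.6 (Thm. 6.1, Kodaira–Néron) and C.16; Petsche 2006, display (10).
An `abbrev` (reducible), see the design notes.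
(Dot-notation extension of the Mathlib namespace `WeierstrassCurve`.) [cite: Petsche2006, (10)] -/
abbrev tamagawaNumberAt (v : HeightOneSpectrum A) (W : WeierstrassCurve K) : ℕ :=
  (W.baseChange (v.adicCompletion K)).localTamagawaNumber (v.adicCompletionIntegers K)

/-- Unfolding lemma: `c_v` is `localTamagawaNumber` over the completion at `v`. [folklore] -/
theorem tamagawaNumberAt_def (v : HeightOneSpectrum A) (W : WeierstrassCurve K) :
    W.tamagawaNumberAt v =
      (W.baseChange (v.adicCompletion K)).localTamagawaNumber (v.adicCompletionIntegers K) := rfl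

end TamagawaAt

section NumberField

open NumberField

/-- Over a number field, the Tamagawa product of `Tamagawa.lean` is `∏ᶠ_v c_v` with
`c_v = W.tamagawaNumberAt v` (definitional). [folklore] -/
theorem tamagawaProduct_eq_finprod_tamagawaNumberAt {K : Type*} [Field K] [NumberField K]
    (W : WeierstrassCurve K) :
    W.tamagawaProduct = ∏ᶠ v : HeightOneSpectrum (𝓞 K), W.tamagawaNumberAt v := rfl

end NumberField

end WeierstrassCurve

/-! ### Petsche's Lemma 3 over `ℚ` (named fact) -/

namespace Literature.NumberTheory.EllipticCurves

open Petsche2006 Rat.HeightOneSpectrum _root_.WeierstrassCurve _root_.WeierstrassCurve.Affine.Point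

/-- **Petsche 2006, Lemma 3** (p. 260), at a finite place `v` of `ℚ` and for rational points:
*Let `E/k` be an elliptic curve, let `v` be a non-archimedean place of `k`, and let `Δ_v ∈ 𝒪_v` be
the discriminant of a minimal Weierstrass equation for `E/k_v`. If `Z ⊂ E(k_v)` is a set of `N`
distinct `k_v`-rational points, then `Λ_v(Z) ≥ (1/c_v² − 1/N) (1/12) log|1/Δ_v|_v`,* where
`c_v = |E(k_v)/E₀(k_v)|` (display (10)) and `Λ_v(Z) = N⁻² Σ_{i≠j} λ_v(P_i − P_j)` (display (7)).
Printed proof: decomposition `λ_v(P − Q) = i_v(P,Q) + j_v(P,Q)` (Rumely), `i_v ≥ 0` and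
`i_v ≥ (1/12)(log|1/Δ_v|_v − log⁺|j_E|_v)` on `E₀` (ATAEC VI.4.1), a counting argument over the
cosets of `E₀(k_v)`, and for `|j_E|_v > 1` Tate's uniformisation with
`j_v = ½ B₂(r(P−Q)) log|j_E|_v` and the positivity of the Fourier coefficients of `B₂`. Over `ℚ` at
`v ↔ p_v`: `log|1/Δ_v|_v = ord_v(Δ_min) · log p_v` (`W.ordMinimalDiscriminant v`,
`Rat.HeightOneSpectrum.natGenerator v`), `c_v = W.tamagawaNumberAt v`, `λ_v` restricted to
`E(ℚ)` is `neronLocalHeight (padicAbv v)` (Tate's series, ATAEC VI.1.1), `Z ⊆ E(ℚ)` finite and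
non-empty. [cite: Petsche2006, Lemma 3] -/
def Petsche2006_lemma3 : Prop :=
  ∀ (W : WeierstrassCurve ℚ) [W.IsElliptic] (v : HeightOneSpectrum ℤ) (Z : Finset W.toAffine.Point),
    Z.Nonempty →
      (1 / (W.tamagawaNumberAt v : ℝ) ^ 2 - 1 / (Z.card : ℝ)) *
          (1 / 12 * ((W.ordMinimalDiscriminant v : ℝ) * Real.log (natGenerator v))) ≤
        localHeightDiscSum (padicAbv v) Z

end Literature.NumberTheory.EllipticCurves

end
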